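import Literature.NumberTheory.LFunctions.KMVHeckeRecursionExactAFE
import Literature.NumberTheory.LFunctions.KMVCentralValueSquaredAFE
import HarnessLib

/-!
# Kowalski–Michel–VanderKam 2000, (21)–(22) at every order: KMV's Mellin–Barnes weight
# `W_{ij}(q̂; n₁, n₂)` in closed real form, and its decay «faster than any negative power»
# — STATEMENTS FIRST

Source: E. Kowalski, P. Michel, J. VanderKam, *Non-vanishing of high derivatives of automorphic
`L`-functions at the center of the critical strip*, J. reine angew. Math. 526 (2000) 1–34 [held:
paper:doi-10-1515-crll-2000-074], §4 p. 9 (13)–(15) and §5 p. 12 (21)–(22). The exact formula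
(22) (tree: `KMV2000.kmv2000_eq22`, all orders `k`, `q` prime, `f ∈ S₂(q)^*`)

  `Λ^{(k)}(f,½)² = 2q̂ Σ_{n₁,n₂} λ_f(n₁)λ_f(n₂)(n₁n₂)^{−1/2} (1/2πi)∫_{(3)} (q̂ᵗΓ(1+t)n₁^{−t})^{(k)} (q̂ᵗΓ(1+t)n₂^{−t})^{(k)} dt/t`

carries the weight `W_{ij}(q̂;n₁,n₂) = (1/2πi)∫_{(3)} D_i(q̂;n₁,t) D_j(q̂;n₂,t) dt/t`,
`D_i(q̂;n,t) = ∂ᵢ/∂tⁱ[q̂ᵗΓ(1+t)n^{−t}]` (tree: `KMV2000.afeW q̂ i j n₁ n₂`, `KMV2000.afeKernel`). KMV, p. 12: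
«Again, derivatives of `Γ(1+t)` will contribute lower orders of magnitude in `log q̂` (…) (for the
exact value of their contributions, simply carry through this proof with `Γ^{(ℓ)}` replacing one or
both of the `Γ`'s, and `k − ℓ` replacing either `k`). Thus we need only consider
`Λ_main^{(k)}(f,1/2)² = 2q̂ Σ λ_f(n₁)λ_f(n₂)(n₁n₂)^{−1/2} (log q̂/n₁)^k (log q̂/n₂)^k W(n₁n₂/q̂²)` (21) where
`W(y) = (1/2πi)∫_{(3)} Γ(1+t)² y^{−t} dt/t` (22) decays faster than any negative power of `y`»; and
p. 9 (15): «`V_total(y) = O_N(y^{−N})` for all `N ≥ 1` when `y` is large».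

## What is here (statements first; cell landau-siegel / ls-inputs, line H-AFE2 of K-INPUTS-11)

* `KMV2000.logCutoffW i j a₁ a₂ y` — the weight in CLOSED REAL FORM:
  `W_{ij}(a₁, a₂; y) := ∫_{x₁>0} e^{−x₁} (a₁ + log x₁)^i ∫_{x₂ > y/x₁} e^{−x₂} (a₂ + log x₂)^j dx₂ dx₁`,
  i.e. `∫∫_{x₁x₂ > y} e^{−x₁−x₂}(a₁+log x₁)^i(a₂+log x₂)^j`. Since
  `D_i(q̂;n,t) = (q̂/n)ᵗ ∫_0^∞ e^{−x}(log(q̂/n) + log x)^i xᵗ dx` (differentiate Euler's integral `i` times)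
  and `(1/2πi)∫_{(3)} Xᵗ dt/t = 1_{X>1}`, the companion proof files establish the REAL-FORM BRIDGE
  `afeW q̂ i j n₁ n₂ = W_{ij}(log(q̂/n₁), log(q̂/n₂); n₁n₂/q̂²)` (`n₁, n₂ ≥ 1`, `q̂ > 0`); at `i = j = 0`
  the inner integral is `e^{−y/x₁}` and `W_{00}(a₁,a₂;y) = KMV2000.cutoffW y` (the tree's `W` of (22), real
  form `∫_0^∞ e^{−u−y/u} du`; bridge `afeW_zero_zero_eq_cutoffW`). Expanding `(log(q̂/n)+log x)^k`
  binomially exhibits the printed main term `(log q̂/n₁)^k (log q̂/n₂)^k W(n₁n₂/q̂²)` of (21) plus the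
  `Γ^{(ℓ)}`-corrections KMV describe in words.
* `KMV2000.afeW_decay` — the NAMED STATEMENT «decays faster than any negative power» for the
  all-order weight, UNIFORMLY in `q̂`: for all orders `i, j` and every `A ≥ 0` there is `C = C(i,j,A)` with
  `‖W_{ij}(q̂;n₁,n₂)‖ ≤ C · (q̂²/(n₁n₂))^A · (1+|log(q̂/n₁)|)^i · (1+|log(q̂/n₂)|)^j` (`q̂ > 0`, `n₁,n₂ ≥ 1`).
  The two log factors are the printed `(log q̂/n₁)^k (log q̂/n₂)^k` of (21); at `i = j = 0` the statement
  is `W(y) ≪_A y^{−A}` (`y = n₁n₂/q̂²`), p. 12 / (15) p. 9 verbatim. It is PROVED in the companion files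
  (Rankin's trick on the real form: `1_{x₁x₂>y} ≤ (x₁x₂/y)^A`), so it is a statement of record, not an input.

## Not here

No proof, no moments, no mollifier; the identity (22) itself is `KMV2000.kmv2000_eq22` (typed in
`KMVHeckeRecursionExactAFE`; its `k = 0` row is the theorem `kmv2000_eq22_zero_holds`). No claim about
Landau–Siegel zeros.
-/

noncomputable section

open scoped Real
open Complex Set MeasureTheory

namespace Literature.NumberTheory.LFunctions.KMV2000

/-! ### The all-order weight in closed real form -/

/-- **KMV's all-order AFE weight in closed real form**:
`W_{ij}(a₁, a₂; y) := ∫_{x₁ > 0} e^{−x₁} (a₁ + log x₁)^i ( ∫_{x₂ > y/x₁} e^{−x₂} (a₂ + log x₂)^j dx₂ ) dx₁`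
`= ∫∫_{x₁ x₂ > y} e^{−x₁−x₂} (a₁ + log x₁)^i (a₂ + log x₂)^j dx₁ dx₂` (`y ≥ 0`; both integrals converge
absolutely: the integrand is `e^{−x}` times a polynomial in `log x`). With `a_ν = log(q̂/n_ν)` and
`y = n₁n₂/q̂²` this is `(1/2πi)∫_{(3)} (q̂ᵗΓ(1+t)n₁^{−t})^{(i)} (q̂ᵗΓ(1+t)n₂^{−t})^{(j)} dt/t` = the tree's
`KMV2000.afeW q̂ i j n₁ n₂` (proved in the companion files); `W_{00}(a₁,a₂;y) = KMV2000.cutoffW y` = `W(y)` of (22),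
and the binomial expansion of `(a_ν + log x_ν)^k` gives the main term `(log q̂/n₁)^k (log q̂/n₂)^k W(n₁n₂/q̂²)`
of (21). [cite: KowalskiMichelVanderKam2000, (21)–(22) p. 12 (with p. 12 «carry through this proof with Γ^{(ℓ)} replacing one or both of the Γ's»)] -/
def logCutoffW (i j : ℕ) (a₁ a₂ y : ℝ) : ℝ :=
  ∫ x₁ in Ioi (0 : ℝ), Real.exp (-x₁) * (a₁ + Real.log x₁) ^ i *
    ∫ x₂ in Ioi (y / x₁), Real.exp (-x₂) * (a₂ + Real.log x₂) ^ j

/-! ### The named statement: decay faster than any negative power, uniformly in `q̂` -/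

/-- **KMV 2000, (22) p. 12 / (15) p. 9 — the AFE weight decays faster than any negative power.**
Printed: «`W(y) = (1/2πi)∫_{(3)} Γ(1+t)² y^{−t} dt/t` decays faster than any negative power of `y`» (22),
«`V_total(y) = O_N(y^{−N})` for all `N ≥ 1`» (15), and for the `Γ^{(ℓ)}`-corrected weights «simply carry
through this proof with `Γ^{(ℓ)}` replacing one or both of the `Γ`'s». Typed for the tree's all-order
Mellin–Barnes weight `KMV2000.afeW q̂ i j n₁ n₂` of the exact formula `KMV2000.kmv2000_eq22`, UNIFORMLY in
`q̂ > 0`: for all `i j : ℕ` and every exponent `A ≥ 0` there is a constant `C` (depending on `i, j, A` only)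
such that for all `q̂ > 0` and `n₁, n₂ ≥ 1`,
`‖afeW q̂ i j n₁ n₂‖ ≤ C · (q̂²/(n₁n₂))^A · (1 + |log(q̂/n₁)|)^i · (1 + |log(q̂/n₂)|)^j`
(the log factors are the `(log q̂/n₁)^k (log q̂/n₂)^k` of (21); `i = j = 0`: `W(n₁n₂/q̂²) ≪_A (q̂²/n₁n₂)^A`).
[cite: KowalskiMichelVanderKam2000, (22) p. 12 and (15) p. 9] -/
def afeW_decay : Prop :=
  ∀ (i j : ℕ) (A : ℝ), 0 ≤ A → ∃ C : ℝ, ∀ (qh : ℝ), 0 < qh → ∀ (n₁ n₂ : ℕ), n₁ ≠ 0 → n₂ ≠ 0 →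
    ‖afeW qh i j n₁ n₂‖ ≤
      C * (qh ^ 2 / ((n₁ : ℝ) * n₂)) ^ A *
        (1 + |Real.log (qh / n₁)|) ^ i * (1 + |Real.log (qh / n₂)|) ^ j

end Literature.NumberTheory.LFunctions.KMV2000

end
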